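import Summits.BirchSwinnertonDyer.BirchSwinnertonDyer.Theorems.ManinLocalTwoThreeEvenSpanPrimePow

/-!
# THE WASHING LEMMA AT A PRIME-POWER MODULUS `p^e` (P-es-7, step H1b of MEMO-es §38.5-bis; cell bsd-f2-manin, seat `bsd-line-manin23-p2`
# gen 12): `…UnitTwistOfLevelDifference` with `p ↦ p^e`

Summit `BirchSwinnertonDyer`, route `ManinLocalTwoThree`, crux C2 `ManinOddAtFour` (stmt-BirchSwinnertonDyer-22967), v14 stub 6 (blind-locus /
Γ₁ half, es E-es-111♯ `GammaOneTowerUnitTwist`).  Continuation of `…EvenSpanPrimePow` (the level-`n` descent modulo `p^e`): the Euler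
cofactors at the primes `ℓ ∥ N` are `p`-units with integral cofactors (tree: `exists_cofactor_mul_eq_int_of_pow_ne_one`,
`exists_cofactor_prod_mul_eq_int`, LEMMA W `wieferichLevel`), so the mod-`p^e` unit property `∀ s, p ∤ s → s·r/p^e ∉ ℤ̄` passes from the raw
twisted sum to the Euler-corrected one.

* `not_isIntegral_mul_of_cofactor_primePow`; `exists_unitTwist_of_levelDifference_primePow` — a level-`n` difference (`n ≥ 2` above the
  Wieferich levels) with plus part `p^e ∤ j` gives a PRIMITIVE EVEN `χ` of conductor `qⁿ` whose Euler-corrected twisted sum is `r·Ω⁺_f` with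
  `s·r/p^e ∉ ℤ̄` (`p ∤ s`); the contrapositive **`plus_primePow_dvd_of_forall_not_unitTwist`** = (TV) modulo `p^e`.

HONEST FRAMING: bookkeeping toward P-es-7 (E-es-111♯); nothing about Manin's conjecture or BSD is asserted; C2/C3 OPEN.  No definitions,
no named facts, no sorry.
-/

set_option linter.dupNamespace false
set_option autoImplicit false

noncomputable section

open scoped Classical MatrixGroups ModularForm ComplexConjugate

open CongruenceSubgroup Complex Literature.NumberTheory.EllipticCurves
  Literature.NumberTheory.EllipticCurves.ModularForms
  Summit.BirchSwinnertonDyer.Rank1Residual.ManinAdditive.KatoCurve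

namespace Summit.BirchSwinnertonDyer.BirchSwinnertonDyer.Theorems.ManinLocalTwoThree

/-! ### §1 Euler cofactors and the washing lemma modulo `p^e` -/

/-- (`not_isIntegral_mul_of_cofactor` at the modulus `p^k`.) **Transport of the unit clause through a `p`-unit factor**: if `e·c = t` with `c` an algebraic integer and `p ∤ t`,
and `s·r/p` is not an algebraic integer for any `s` prime to `p`, then `s·(e·r)/p` is not an algebraic integer for any `s`
prime to `p`. [folklore] -/
theorem not_isIntegral_mul_of_cofactor_primePow {p : ℕ} (hp : p.Prime) (k : ℕ) {e c r : ℂ} {t : ℤ} (hc : IsIntegral ℤ c)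
    (het : e * c = t) (hpt : ¬ (p : ℤ) ∣ t) (hr : ∀ s : ℕ, ¬ p ∣ s → ¬ IsIntegral ℤ ((s : ℂ) * r / (p : ℂ) ^ k))
    (s : ℕ) (hs : ¬ p ∣ s) : ¬ IsIntegral ℤ ((s : ℂ) * (e * r) / (p : ℂ) ^ k) := by
  intro hI
  -- multiply by the cofactor: `s·t·r/p` is integral
  have h1 : IsIntegral ℤ (((s * t.natAbs : ℕ) : ℂ) * r / (p : ℂ) ^ k) := by
    have e1 : (((s * t.natAbs : ℕ) : ℂ) * r / (p : ℂ) ^ k) = ((t.sign : ℤ) : ℂ) * (c * ((s : ℂ) * (e * r) / (p : ℂ) ^ k)) := by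
      have hn : ((t.natAbs : ℕ) : ℂ) = ((t.sign : ℤ) : ℂ) * (t : ℂ) := by
        rw [Nat.cast_natAbs, ← Int.sign_mul_self_eq_abs]; push_cast; ring
      have e2 : ((t.sign : ℤ) : ℂ) * (c * ((s : ℂ) * (e * r) / (p : ℂ) ^ k)) = ((t.sign : ℤ) : ℂ) * (e * c) * ((s : ℂ) * r) / (p : ℂ) ^ k := by
        ring
      rw [e2, het, Nat.cast_mul, hn]
      ring
    rw [e1]
    exact (isIntegral_algebraMap (R := ℤ) (x := t.sign)).mul (hc.mul hI)
  refine hr (s * t.natAbs) ?_ h1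
  intro h
  rcases (Nat.Prime.dvd_mul hp).mp h with h' | h'
  · exact hs h'
  · exact hpt (Int.natCast_dvd.mpr h')

variable {W : WeierstrassCurve ℚ} {N : ℕ} [NeZero N] {f : CuspForm (Gamma0 N) 2}

/-- **A bad level-`n` difference (plus part NOT divisible by `p^e`) above the Wieferich level gives a primitive even twist of conductor `qⁿ`
whose Euler-corrected value is a UNIT MODULO `p^e`** (`∀ s, p ∤ s → s·r/p^e ∉ ℤ̄`; `exists_unitTwistAt_of_levelDifference` is `e = 1`).
ORIGINAL DOCSTRING: **A bad level-`n` difference above the Wieferich level gives a unit twist of conductor `qⁿ`** (MEMO-an §71.3 «⟸» + §71.2 side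
conditions): for the newform `f` of `W`, a prime `p`, an odd prime `q ∤ N`, `q ≠ p`, `p ∤ (q-1)/2`, a level `n ≥ 2` exceeding
`v_q((ℓ^{p-1})^{q-1} − 1)` for every `ℓ ∥ N`, and a difference `{∞,(b+tq^{n-1})/qⁿ}_f − {∞,b/qⁿ}_f` (`q ∤ b`) with plus part `j·Ω⁺_f`,
`p ∤ j`: some PRIMITIVE EVEN `χ` mod `qⁿ` has `e_S(χ)·Σ_a χ(a){∞,a/qⁿ}_f = r·Ω⁺_f` with `s·r/p` never an algebraic integer (`p ∤ s`). -/
theorem exists_unitTwist_of_levelDifference_primePow (hWf : IsNewformOf W f) {p : ℕ} (hp : p.Prime) (e : ℕ)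
    {q : ℕ} [Fact q.Prime] (hq2 : q ≠ 2) (hqp : q ≠ p) (hqN : ¬ q ∣ N) (hpq : ¬ p ∣ (q - 1) / 2)
    {n : ℕ} (hn2 : 2 ≤ n)
    (hnW : ∀ ℓ ∈ N.primeFactors, ¬ ℓ ^ 2 ∣ N → padicValNat q ((ℓ ^ (p - 1)) ^ (q - 1) - 1) < n)
    {b t : ℤ} (hb : ¬ (q : ℤ) ∣ b) {j : ℤ}
    (hj : (modularSymbol f (((b + t * (q : ℤ) ^ (n - 1) : ℤ) : ℚ) / (q : ℚ) ^ n) - modularSymbol f ((b : ℚ) / (q : ℚ) ^ n)) +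
        conj (modularSymbol f (((b + t * (q : ℤ) ^ (n - 1) : ℤ) : ℚ) / (q : ℚ) ^ n) -
          modularSymbol f ((b : ℚ) / (q : ℚ) ^ n)) = (j : ℂ) * (plusPeriod f : ℂ))
    (hjp : ¬ ((p : ℤ) ^ e) ∣ j) :
    ∃ χ : DirichletCharacter ℂ (q ^ n), χ.IsPrimitive ∧ χ.Even ∧
      ∃ r : ℂ,
        (∏ ℓ ∈ N.primeFactors with ¬ ℓ ^ 2 ∣ N,
            (((ℓ : ℂ) - (W.LFunction ℓ : ℂ) * χ (ℓ : ZMod (q ^ n))) *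
              ((ℓ : ℂ) - (W.LFunction ℓ : ℂ) * (χ (ℓ : ZMod (q ^ n)))⁻¹))) *
            twistedSymbolSum f χ = r * (plusPeriod f : ℂ) ∧
        ∀ s : ℕ, ¬ p ∣ s → ¬ _root_.IsIntegral ℤ ((s : ℂ) * r / (p : ℂ) ^ e) := by
  have hq : q.Prime := Fact.out
  have hf : IsNewform0 f := hWf.1
  have hQ : coeffField f = ⊥ := hWf.coeffField_eq_bot
  have hq3 : 3 ≤ q := by
    rcases hq.eq_two_or_odd' with h | h
    · exact absurd h hq2
    · have := hq.two_le; rcases h with ⟨k, hk⟩; omega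
  -- the descent at level `n`
  obtain ⟨χ, r₀, hprim, hev, hr₀, hunit⟩ :=
    exists_primitive_even_unit_twist_of_levelDifference_primePow hf hQ hp e hq2 hqp hqN hpq hn2 hb hj hjp
  haveI : NeZero (q ^ n) := ⟨pow_ne_zero _ hq.ne_zero⟩
  have hn1 : 1 ≤ n := by omega
  -- an exponent `d` prime to `p` killing `χ`: `d = q^{n-1}·(q-1)/2`
  set d : ℕ := q ^ (n - 1) * ((q - 1) / 2) with hdd
  have hχd : χ ^ d = 1 := pow_half_totient_eq_one_of_even hq hq2 hn1 hev
  have hd0 : 0 < d := Nat.mul_pos (pow_pos hq.pos _) (by omega)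
  have hpd : ¬ p ∣ d := by
    intro h
    rcases (Nat.Prime.dvd_mul hp).mp h with h1 | h1
    · exact hqp ((Nat.prime_dvd_prime_iff_eq hp hq).mp (hp.dvd_of_dvd_pow h1)).symm
    · exact hpq h1
  set S : Finset ℕ := N.primeFactors.filter (fun ℓ ↦ ¬ ℓ ^ 2 ∣ N) with hS
  -- each Euler factor at `ℓ ∥ N` is a `p`-unit with an integral cofactor
  have hU : ∀ ℓ ∈ S, ∃ (c : ℂ) (t : ℤ), IsIntegral ℤ c ∧
      (((ℓ : ℂ) - (W.LFunction ℓ : ℂ) * χ (ℓ : ZMod (q ^ n))) *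
        ((ℓ : ℂ) - (W.LFunction ℓ : ℂ) * (χ (ℓ : ZMod (q ^ n)))⁻¹)) * c = t ∧ ¬ (p : ℤ) ∣ t := by
    intro ℓ hℓS
    obtain ⟨hℓN, hℓ2⟩ := Finset.mem_filter.mp hℓS
    have hℓ : ℓ.Prime := Nat.prime_of_mem_primeFactors hℓN
    have hℓdvd : ℓ ∣ N := Nat.dvd_of_mem_primeFactors hℓN
    -- `a_ℓ = ±1`
    have ha : W.LFunction ℓ = 1 ∨ W.LFunction ℓ = -1 := by
      have h1 := hf.cuspCoeff_sq_eq_one_of_dvd_of_not_sq_dvd hℓ hℓdvd hℓ2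
      rw [hWf.2 ℓ] at h1
      have h2 : (W.LFunction ℓ) ^ 2 = 1 := by exact_mod_cast h1
      exact sq_eq_one_iff.mp h2
    have hqℓ : ¬ q ∣ ℓ := fun h ↦ hqN (((Nat.prime_dvd_prime_iff_eq hq hℓ).mp h) ▸ hℓdvd)
    have hℓunit : IsUnit ((ℓ : ℕ) : ZMod (q ^ n)) :=
      (ZMod.isUnit_iff_coprime ℓ (q ^ n)).mpr
        (Nat.Coprime.pow_right _ (Nat.coprime_comm.mp ((Nat.Prime.coprime_iff_not_dvd hq).mpr hqℓ)))
    obtain ⟨u, hu⟩ := hℓunit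
    have hζd : χ (ℓ : ZMod (q ^ n)) ^ d = 1 := by
      rw [← hu, ← MulChar.pow_apply_coe, hχd, MulChar.one_apply_coe]
    -- LEMMA W at `x = ℓ^{p-1}`: `χ(ℓ)^{p-1} ≠ 1`
    have hζp : χ (ℓ : ZMod (q ^ n)) ^ (p - 1) ≠ 1 := by
      have hx1 : 1 < ℓ ^ (p - 1) := Nat.one_lt_pow (by have := hp.two_le; omega) hℓ.one_lt
      have hqx : ¬ q ∣ ℓ ^ (p - 1) := fun h ↦ hqℓ (hq.dvd_of_dvd_pow h)
      have hW := wieferichLevel q (ℓ ^ (p - 1)) n hq hq2 hx1 hqx (hnW ℓ hℓN hℓ2) χ hprim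
      rwa [Nat.cast_pow, map_pow] at hW
    -- `χ(ℓ)² ≠ 1`
    have hζ2 : χ (ℓ : ZMod (q ^ n)) ^ 2 ≠ 1 := by
      intro h2
      by_cases hp2 : p = 2
      · subst hp2
        have hζ1 : χ (ℓ : ZMod (q ^ n)) ≠ 1 := by simpa using hζp
        have hneg : χ (ℓ : ZMod (q ^ n)) = -1 := (sq_eq_one_iff.mp h2).resolve_left hζ1
        have hdodd : Odd d := Nat.odd_iff.mpr (Nat.two_dvd_ne_zero.mp hpd)
        rw [hneg, hdodd.neg_one_pow] at hζd
        norm_num at hζd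
      · have h2p : 2 ∣ p - 1 := by
          rcases hp.eq_two_or_odd with h | h
          · exact absurd h hp2
          · omega
        obtain ⟨k, hk⟩ := h2p
        apply hζp
        rw [hk, pow_mul, h2, one_pow]
    exact exists_cofactor_mul_eq_int_of_pow_ne_one hp ℓ ha hd0 hpd hζd hζp hζ2
  obtain ⟨C, T, hC, hET, hpT⟩ := exists_cofactor_prod_mul_eq_int hp S
    (fun ℓ ↦ ((ℓ : ℂ) - (W.LFunction ℓ : ℂ) * χ (ℓ : ZMod (q ^ n))) *
      ((ℓ : ℂ) - (W.LFunction ℓ : ℂ) * (χ (ℓ : ZMod (q ^ n)))⁻¹)) hU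
  refine ⟨χ, hprim, hev,
    (∏ ℓ ∈ S, ((ℓ : ℂ) - (W.LFunction ℓ : ℂ) * χ (ℓ : ZMod (q ^ n))) *
      ((ℓ : ℂ) - (W.LFunction ℓ : ℂ) * (χ (ℓ : ZMod (q ^ n)))⁻¹)) * r₀, ?_, ?_⟩
  · rw [hr₀, mul_assoc]
  · exact not_isIntegral_mul_of_cofactor_primePow hp e hC hET hpT hunit

/-- **(TV) modulo `p^e` at level `n` from the absence of twists that are units modulo `p^e`** (contrapositive of
`exists_unitTwist_of_levelDifference_primePow`): if no primitive even `χ` of conductor `qⁿ` (`n ≥ 2` above the Wieferich levels) has an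
Euler-corrected value `r·Ω⁺_f` with `s·r/p^e ∉ ℤ̄` for all `p ∤ s`, then every level-`n` difference has plus part `j·Ω⁺_f` with `p^e ∣ j`. -/
theorem plus_primePow_dvd_of_forall_not_unitTwist [W.IsElliptic] (hWf : IsNewformOf W f) {p : ℕ} (hp : p.Prime) (e : ℕ)
    {q : ℕ} [Fact q.Prime] (hq2 : q ≠ 2) (hqp : q ≠ p) (hqN : ¬ q ∣ N) (hpq : ¬ p ∣ (q - 1) / 2)
    {n : ℕ} (hn2 : 2 ≤ n)
    (hnW : ∀ ℓ ∈ N.primeFactors, ¬ ℓ ^ 2 ∣ N → padicValNat q ((ℓ ^ (p - 1)) ^ (q - 1) - 1) < n)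
    (hno : ∀ χ : DirichletCharacter ℂ (q ^ n), χ.IsPrimitive → χ.Even →
      ¬ ∃ r : ℂ,
        (∏ ℓ ∈ N.primeFactors with ¬ ℓ ^ 2 ∣ N,
            (((ℓ : ℂ) - (W.LFunction ℓ : ℂ) * χ (ℓ : ZMod (q ^ n))) *
              ((ℓ : ℂ) - (W.LFunction ℓ : ℂ) * (χ (ℓ : ZMod (q ^ n)))⁻¹))) *
            twistedSymbolSum f χ = r * (plusPeriod f : ℂ) ∧
        ∀ s : ℕ, ¬ p ∣ s → ¬ _root_.IsIntegral ℤ ((s : ℂ) * r / (p : ℂ) ^ e))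
    {b t : ℤ} (hb : ¬ (q : ℤ) ∣ b) {j : ℤ}
    (hj : (modularSymbol f (((b + t * (q : ℤ) ^ (n - 1) : ℤ) : ℚ) / (q : ℚ) ^ n) - modularSymbol f ((b : ℚ) / (q : ℚ) ^ n)) +
        conj (modularSymbol f (((b + t * (q : ℤ) ^ (n - 1) : ℤ) : ℚ) / (q : ℚ) ^ n) -
          modularSymbol f ((b : ℚ) / (q : ℚ) ^ n)) = (j : ℂ) * (plusPeriod f : ℂ)) :
    ((p : ℤ) ^ e) ∣ j := by
  by_contra hjp
  obtain ⟨χ, hprim, hev, r, hr, hunit⟩ := exists_unitTwist_of_levelDifference_primePow hWf hp e hq2 hqp hqN hpq hn2 hnW hb hj hjp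
  exact hno χ hprim hev ⟨r, hr, hunit⟩

end Summit.BirchSwinnertonDyer.BirchSwinnertonDyer.Theorems.ManinLocalTwoThree

end
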